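import Summits.QuantumFields.YangMills.Theorems.UnitScaleTiltFluctuationComparisonRegPrRepAtHeightsV3FamBase
import Literature.MathematicalPhysics.QuantumFieldTheory.Balaban1983to89.TorusGeometry
import Literature.MathematicalPhysics.QuantumFieldTheory.Balaban1983to89.T3AlphaInputsACTwoRunLevel
import Summits.QuantumFields.YangMills.Theorems.AlphaInputsT3ACv3Pint
import HarnessLib

/-!
# Crux `FluctuationComparisonRegPrL` (stmt-QuantumFields-19935), v5j′ STUB 3″′ `stub_pintDecompTwoRunMinFam`: THE BLOCK DECOMPOSITION, part 1 — BLOCK GEOMETRY of the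
# route's tower of tori within one run and across two cut-offs (support file `--supports stmt-QuantumFields-19935`; part 2 `…TwoRunBlocks.lean` = NOTE N-g4-2 in the kernel)

Fleet seat `ym-ust-19201-p2` (gen 4, v5j pen).  WHAT THIS FILE PROVES (lattice bookkeeping only): the scale-`i` block `blk F K i y` of run `K`'s fine torus over a
level-`i` site (`Carriers.coarsen i ⁻¹ {y}`), its cardinality `L^{3i}` (`card_blkFin`, `TorusGeometry.card_block` iterated along `coarsen (i+1) = blockOf ∘ coarsen i`), the
block family `blocks F K i` (one block per level-`i` site; `card_blocks = sitesPerDir(i)³`; a partition: `sum_blocks_indicator`), and the CROSS-CUT-OFF correspondence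
`siteShift_coarsen_coarsenSite` / `refineSet_blk : refineSet F K (blk F K i y) = blk F (K+1) (i+1) (siteShift _ y)` (`T3LevelShift.siteShift_blockOf` iterated) — so
`refineSet` is a bijection `blocks F K i → blocks F (K+1) (i+1)` (`bijOn_refineSet_blocks`).  No analysis; nothing of Bałaban's is asserted.

References: T. Bałaban, CMP 109 (1987) 249–301 [Balaban1987RG1] ((0.1)–(0.3) pp.251–252); CMP 102 (1985) 255–275 [Balaban1985UV3] ((43)–(46) pp.266–267); C. King, CMP 102
(1986) 649–677 [King1986] (Thm 3.4 (3.9) p.656).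
-/

set_option autoImplicit false

noncomputable section

namespace Summit.QuantumFields.YangMills.Theorems.LogComparisonTwoRunBlocks

open MeasureTheory Filter
open Literature.MathematicalPhysics.QuantumFieldTheory.Balaban1983to89
open Literature.MathematicalPhysics.QuantumFieldTheory.Balaban1983to89.T3ContinuumYM3Torus
open Literature.MathematicalPhysics.QuantumFieldTheory.Balaban1983to89.T3UnitScaleTilt (θBal)
open Literature.MathematicalPhysics.QuantumFieldTheory.Balaban1983to89.T3LevelShift (fieldShift siteShift siteShift_blockOf siteShift_siteShift siteShift_refl)
open Literature.MathematicalPhysics.QuantumFieldTheory.Balaban1983to89.T3AlphaInputsAC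
open Literature.MathematicalPhysics.QuantumFieldTheory.Balaban1983to89.T3AlphaPolymerSocket
open Literature.MathematicalPhysics.QuantumFieldTheory.Balaban1983to89.T3AlphaInputsACTwoRunLevel
open Literature.MathematicalPhysics.QuantumFieldTheory.Balaban1985CMP102
open Literature.MathematicalPhysics.QuantumFieldTheory.Balaban1985CMP102.Setting
open Summit.QuantumFields.Balaban3D.Carriers
open Summit.QuantumFields.Balaban3D.Proofs.Primitives
open Summit.QuantumFields.Balaban3D.Proofs.StandardAC
open Summit.QuantumFields.Balaban3D.Proofs.InputsAC

/-! ## §1 Block geometry of the tower of tori, within one run and across two cut-offs -/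

section Geometry

variable (F : T3Family) (K : ℕ)

/-- The scale-`i` BLOCK of run `K`'s fine torus over the level-`i` site `y`: the fine sites whose `i`-fold block label is `y` (`Carriers.coarsen`).
[cite: Balaban1987RG1, (0.3) p.252] -/
def blk (i : ℕ) (y : Site (F.P K) i) : Set (Site (F.P K) 0) := {x | coarsen i x = y}

/-- The same block as a `Finset`. [cite: Balaban1987RG1, (0.3) p.252] -/
def blkFin (i : ℕ) (y : Site (F.P K) i) : Finset (Site (F.P K) 0) := Finset.univ.filter fun x => coarsen i x = y

/-- Membership in `blkFin` (definitional). [folklore] -/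
theorem mem_blkFin {i : ℕ} {y : Site (F.P K) i} {x : Site (F.P K) 0} : x ∈ blkFin F K i y ↔ coarsen i x = y := by
  simp [blkFin]

/-- Every fine site lies in the block over its own label. [folklore] -/
theorem mem_blk_self (i : ℕ) (x : Site (F.P K) 0) : x ∈ blk F K i (coarsen i x) := rfl

/-- `(F.P K).d = 3` (definitional). [folklore] -/
theorem d_eq : (F.P K).d = 3 := rfl

/-- **A SCALE-`i` BLOCK HAS EXACTLY `L^{3i}` FINE SITES** (`i ≤ m + K`; `TorusGeometry.card_block` iterated along `coarsen (i+1) = blockOf ∘ coarsen i`).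
[cite: Balaban1987RG1, (0.3) p.252] -/
theorem card_blkFin : ∀ (i : ℕ), i ≤ F.m + K → ∀ y : Site (F.P K) i, (blkFin F K i y).card = F.L ^ (3 * i)
  | 0, _, y => by
    have h : blkFin F K 0 y = {y} := by
      ext x
      simp [blkFin, coarsen]
    rw [h, Finset.card_singleton, mul_zero, pow_zero]
  | i + 1, hi, y => by
    classical
    have hP : i + 1 ≤ (F.P K).m + (F.P K).K := hi
    -- the block over `y` at scale `i+1` is the disjoint union over the scale-`i` sites `z ∈ block y` of the blocks over `z`
    have hdecomp : blkFin F K (i + 1) y = (block y).biUnion fun z => blkFin F K i z := by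
      ext x
      simp only [mem_blkFin, Finset.mem_biUnion, block, Finset.mem_filter, Finset.mem_univ, true_and, coarsen_succ]
      constructor
      · intro hx
        exact ⟨coarsen i x, hx, rfl⟩
      · rintro ⟨z, hz, hxz⟩
        rw [hxz]
        exact hz
    rw [hdecomp, Finset.card_biUnion]
    · have hconst : ∀ z ∈ block y, (blkFin F K i z).card = F.L ^ (3 * i) := fun z _ => card_blkFin i (by omega) z
      rw [Finset.sum_congr rfl hconst, Finset.sum_const, Site.card_block hP, smul_eq_mul, d_eq]
      show (F.P K).L ^ 3 * F.L ^ (3 * i) = F.L ^ (3 * (i + 1))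
      rw [show (F.P K).L = F.L from rfl]
      ring
    · intro z _ z' _ hzz'
      exact Finset.disjoint_filter.mpr fun x _ hx hx' => hzz' (hx.symm.trans hx')

/-- The indicator count of a block IS the cardinality of its `Finset`. [folklore] -/
theorem sum_indicator_blk (i : ℕ) (y : Site (F.P K) i) :
    ∑ x : Site (F.P K) 0, (blk F K i y).indicator (fun _ => (1 : ℝ)) x = ((blkFin F K i y).card : ℝ) := by
  classical
  have h : ∀ x : Site (F.P K) 0, (blk F K i y).indicator (fun _ => (1 : ℝ)) x = if coarsen i x = y then 1 else 0 := by
    intro x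
    by_cases hx : coarsen i x = y
    · rw [if_pos hx, Set.indicator_of_mem (show x ∈ blk F K i y from hx)]
    · rw [if_neg hx, Set.indicator_of_notMem (show x ∉ blk F K i y from hx)]
  simp_rw [h]
  rw [Finset.sum_ite, Finset.sum_const_zero, add_zero, Finset.sum_const, nsmul_eq_mul, mul_one]
  rfl

/-- **THE BLOCK FAMILY OF SCALE `i`**: one block per level-`i` site. [cite: Balaban1987RG1, (0.3) p.252] -/
def blocks (i : ℕ) : Finset (Set (Site (F.P K) 0)) := Finset.univ.image (blk F K i)

/-- Distinct labels give distinct blocks (blocks are non-empty in the standing range: `coarsen_surjective`). [folklore] -/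
theorem blk_injective {i : ℕ} (hi : i ≤ F.m + K) : Function.Injective (blk F K i) := by
  intro y y' h
  obtain ⟨x, hx⟩ := coarsen_surjective (P := F.P K) i hi y
  have hx' : x ∈ blk F K i y' := by rw [← h]; exact hx
  exact hx.symm.trans hx'

/-- **THE NUMBER OF SCALE-`i` BLOCKS IS `sitesPerDir(i)³`**. [cite: Balaban1987RG1, (0.1) p.251] -/
theorem card_blocks {i : ℕ} (hi : i ≤ F.m + K) : (blocks F K i).card = (F.P K).sitesPerDir i ^ 3 := by
  rw [blocks, Finset.card_image_of_injective _ (blk_injective F K hi), Finset.card_univ, Site.card_site, d_eq]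

/-- **THE BLOCKS PARTITION THE FINE TORUS**: every fine site lies in exactly one scale-`i` block, so the indicator sum over the family is `1`. [folklore] -/
theorem sum_blocks_indicator {i : ℕ} (hi : i ≤ F.m + K) (x : Site (F.P K) 0) :
    ∑ Y ∈ blocks F K i, Y.indicator (fun _ => (1 : ℝ)) x = 1 := by
  classical
  rw [blocks, Finset.sum_image fun y _ y' _ h => blk_injective F K hi h]
  rw [Finset.sum_eq_single (coarsen i x)]
  · rw [Set.indicator_of_mem (mem_blk_self F K i x)]
  · intro y _ hy
    exact Set.indicator_of_notMem (show x ∉ blk F K i y from fun hx : coarsen i x = y => hy hx.symm) (fun _ => (1 : ℝ))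
  · intro h
    exact absurd (Finset.mem_univ _) h

/-! ### Across two cut-offs -/

/-- The level identification `(F.P K)_i ≃ (F.P (K+1))_{i+1}` (same physical scale). [cite: Balaban1987RG1, (0.1) p.251] -/
theorem sitesPerDir_succ_eq (i : ℕ) : (F.PP F.m K).sitesPerDir i = (F.PP F.m (K + 1)).sitesPerDir (i + 1) :=
  F.sitesPerDir_eq (m := F.m) (K := K) (j := i) (m' := F.m) (K' := K + 1) (j' := i + 1) (by omega)

/-- **COARSENING ACROSS THE CUT-OFF COMMUTES WITH THE BLOCK MAPS**: `siteShift (coarsen_K i (coarsenSite x′)) = coarsen_{K+1} (i+1) x′`. [cite: Balaban1987RG1, (0.1) p.251] -/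
theorem siteShift_coarsen_coarsenSite : ∀ (i : ℕ) (x' : Site (F.P (K + 1)) 0),
    siteShift (sitesPerDir_succ_eq F K i) (coarsen i (coarsenSite F K x')) = coarsen (i + 1) x'
  | 0, x' => by
    show siteShift (sitesPerDir_succ_eq F K 0) ((siteShift _).symm (blockOf x')) = blockOf (coarsen 0 x')
    rw [show coarsen 0 x' = x' from rfl]
    generalize_proofs h
    exact Equiv.apply_symm_apply _ _
  | i + 1, x' => by
    rw [coarsen_succ, coarsen_succ, ← siteShift_coarsen_coarsenSite i x']
    exact siteShift_blockOf (sitesPerDir_succ_eq F K i) (sitesPerDir_succ_eq F K (i + 1)) _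

/-- **REFINING A BLOCK GIVES THE CORRESPONDING BLOCK ONE CUT-OFF FINER**. [cite: Balaban1987RG1, (0.1) p.251] -/
theorem refineSet_blk (i : ℕ) (y : Site (F.P K) i) :
    refineSet F K (blk F K i y) = blk F (K + 1) (i + 1) (siteShift (sitesPerDir_succ_eq F K i) y) := by
  ext x'
  rw [mem_refineSet_iff]
  show coarsen i (coarsenSite F K x') = y ↔ coarsen (i + 1) x' = siteShift (sitesPerDir_succ_eq F K i) y
  rw [← siteShift_coarsen_coarsenSite F K i x']
  exact (siteShift (sitesPerDir_succ_eq F K i)).injective.eq_iff.symm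

/-- **`refineSet` IS A BIJECTION FROM THE SCALE-`i` BLOCKS OF RUN `K` ONTO THE SCALE-`(i+1)` BLOCKS OF RUN `K+1`**. [cite: Balaban1987RG1, (0.1) p.251] -/
theorem bijOn_refineSet_blocks {i : ℕ} (hi : i ≤ F.m + K) :
    Set.BijOn (refineSet F K) ↑(blocks F K i) ↑(blocks F (K + 1) (i + 1)) := by
  classical
  refine ⟨fun Y hY => ?_, fun Y hY Y' hY' h => ?_, fun Y' hY' => ?_⟩
  · obtain ⟨y, -, rfl⟩ := Finset.mem_image.mp (Finset.mem_coe.mp hY)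
    rw [refineSet_blk]
    exact Finset.mem_coe.mpr (Finset.mem_image.mpr ⟨_, Finset.mem_univ _, rfl⟩)
  · obtain ⟨y, -, rfl⟩ := Finset.mem_image.mp (Finset.mem_coe.mp hY)
    obtain ⟨y', -, rfl⟩ := Finset.mem_image.mp (Finset.mem_coe.mp hY')
    rw [refineSet_blk, refineSet_blk] at h
    have hinj := blk_injective F (K + 1) (i := i + 1) (by omega) h
    rw [(siteShift (sitesPerDir_succ_eq F K i)).injective hinj]
  · obtain ⟨y', -, rfl⟩ := Finset.mem_image.mp (Finset.mem_coe.mp hY')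
    refine ⟨blk F K i ((siteShift (sitesPerDir_succ_eq F K i)).symm y'), Finset.mem_coe.mpr (Finset.mem_image.mpr ⟨_, Finset.mem_univ _, rfl⟩), ?_⟩
    rw [refineSet_blk, Equiv.apply_symm_apply]

end Geometry

end Summit.QuantumFields.YangMills.Theorems.LogComparisonTwoRunBlocks

end
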